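import Mathlib.Analysis.Analytic.IsolatedZeros
import Mathlib.Analysis.Calculus.IteratedDeriv.Lemmas
import Literature.NumberTheory.Transcendental.SemialgebraicAlgebraicPoints
import Literature.NumberTheory.Transcendental.SemialgebraicDerivativeProofs
import Literature.ModelTheory.ExponentialFields.SemialgebraicClusterSets

/-!
# `CurvePeriodsTransfer` (stmt-KontsevichZagierPeriods-11129), stub `stub_puiseuxGerm` — brick 1:
# one-sided limits of `ℚ`-semialgebraic functions are algebraic; Taylor coefficients are algebraic

Two inputs of the real Puiseux germ (`stub_puiseuxGerm` of line `standard-etale-models`; verbatim the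
anchor `helper_puiseuxGerm_2` of the sibling crux `RealOnePeriodRelations`):

* `isAlgebraic_of_tendsto_nhdsGT` — if `φ` has `ℚ`-semialgebraic graph over `(a, b)` and a right limit
  `L` at `a`, with `a` algebraic, then `L` is algebraic: the cluster set of `φ` at `a` is `{L}`, and it is
  the fibre over the algebraic point `a` of the CLOSURE of the graph (`mem_clusterSet_iff_snoc_mem_closure`,
  `isSemialgebraic_closure`), a finite `ℚ`-semialgebraic subset of the line, whose points are algebraic
  (`isAlgebraic_of_mem_of_finite`, Lemma T);
* `isAlgebraic_iteratedDeriv` — hence every Taylor coefficient at `0` of a function analytic at `0` whose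
  graph over some `(0, δ)` is `ℚ`-semialgebraic is algebraic (its derivatives are `ℚ`-semialgebraic on a
  rational interval `(0, q)`, `hasDerivAt_isSemialgebraic_holds`, and continuous at `0`).

References: J. Bochnak, M. Coste, M.-F. Roy, *Real Algebraic Geometry* (1998), Prop. 2.2.2, §2.9;
S. Basu, R. Pollack, M.-F. Roy, *Algorithms in Real Algebraic Geometry* (2006), Prop. 3.22.
-/

noncomputable section

open Set Filter Metric
open scoped Topology
open Literature.NumberTheory.Transcendental
open Literature.NumberTheory.Transcendental.SemialgebraicDerivative
open Literature.ModelTheory.ExponentialFields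

namespace Summit.KontsevichZagierPeriods.SymplecticScissors.CurvePeriodsTransfer

namespace PuiseuxGerm

/-! ## Right limits of semialgebraic functions at algebraic points -/

/-- The cluster set at `a⁺` of a function with a right limit `L` at `a`, taken along
`{z | z 0 ∈ (a, b)} ⊆ ℝ¹`, is `{L}`. [folklore] -/
theorem clusterSet_eq_singleton_of_tendsto {φ : ℝ → ℝ} {a b L : ℝ} (hab : a < b)
    (hL : Tendsto φ (𝓝[>] a) (𝓝 L)) :
    clusterSet (fun z : Fin 1 → ℝ => φ (z 0)) {z : Fin 1 → ℝ | z 0 ∈ Ioo a b} (fun _ => a) = {L} := by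
  have hφ := Metric.tendsto_nhdsWithin_nhds.1 hL
  ext v
  simp only [mem_singleton_iff]
  constructor
  · intro hv
    by_contra hne
    have hε : 0 < dist v L / 2 := half_pos (dist_pos.2 hne)
    obtain ⟨δ₁, hδ₁, hδ₁φ⟩ := hφ (dist v L / 2) hε
    obtain ⟨z, hzS, hzp, hzv⟩ := hv (dist v L / 2) hε δ₁ hδ₁
    have hz0 : dist (z 0) a < δ₁ := lt_of_le_of_lt (dist_le_pi_dist z (fun _ => a) 0) hzp
    have h1 : dist (φ (z 0)) L < dist v L / 2 := hδ₁φ (mem_Ioi.2 hzS.1) hz0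
    have h2 : dist v L ≤ dist v (φ (z 0)) + dist (φ (z 0)) L := dist_triangle _ _ _
    rw [dist_comm v (φ (z 0))] at h2
    linarith
  · rintro rfl ε hε δ hδ
    obtain ⟨δ₁, hδ₁, hδ₁φ⟩ := hφ ε hε
    set x : ℝ := a + min (min δ δ₁) (b - a) / 2 with hx
    have hm : 0 < min (min δ δ₁) (b - a) := lt_min (lt_min hδ hδ₁) (sub_pos.2 hab)
    have hxa : a < x := by rw [hx]; linarith
    have hxd : x - a < δ := by
      rw [hx]; linarith [min_le_left (min δ δ₁) (b - a), min_le_left δ δ₁]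
    have hxd₁ : x - a < δ₁ := by
      rw [hx]; linarith [min_le_left (min δ δ₁) (b - a), min_le_right δ δ₁]
    have hxb : x < b := by rw [hx]; linarith [min_le_right (min δ δ₁) (b - a)]
    have hdist : dist x a = x - a := by rw [Real.dist_eq, abs_of_pos (sub_pos.2 hxa)]
    refine ⟨fun _ => x, ⟨hxa, hxb⟩, ?_, ?_⟩
    · rw [dist_pi_lt_iff hδ]
      intro _
      rw [hdist]; exact hxd
    · exact hδ₁φ (mem_Ioi.2 hxa) (by rw [hdist]; exact hxd₁)

/-- **Right limits of `ℚ`-semialgebraic functions at algebraic points are algebraic.** If the graph of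
`φ` over `(a, b)` is `ℚ`-semialgebraic, `a` is algebraic and `φ → L` as `x → a⁺`, then `L` is algebraic
over `ℚ`. [cite: BochnakCosteRoy1998, Prop. 2.2.2] -/
theorem isAlgebraic_of_tendsto_nhdsGT {φ : ℝ → ℝ} {a b L : ℝ} (hab : a < b) (ha : IsAlgebraic ℚ a)
    (hφ : IsSemialgebraicFunOn ℚ {z : Fin 1 → ℝ | z 0 ∈ Ioo a b} (fun z => φ (z 0)))
    (hL : Tendsto φ (𝓝[>] a) (𝓝 L)) : IsAlgebraic ℚ L := by
  -- the closure of the graph is semialgebraic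
  have hΓ : IsSemialgebraic ℚ
      (closure (graphOver {z : Fin 1 → ℝ | z 0 ∈ Ioo a b} (fun z : Fin 1 → ℝ => φ (z 0)))) :=
    isSemialgebraic_closure (isSemialgebraicFunOn_iff_isSemialgebraic_graphOver.1 hφ)
  -- its fibre over the algebraic point `a` is semialgebraic (Tarski–Seidenberg)
  have hFsa : IsSemialgebraic ℚ {y : Fin 1 → ℝ | ∃ t : ℝ, t = a ∧ ((Fin.snoc y t : Fin 2 → ℝ) ∘ ![1, 0]) ∈
      closure (graphOver {z : Fin 1 → ℝ | z 0 ∈ Ioo a b} (fun z : Fin 1 → ℝ => φ (z 0)))} := by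
    refine sa_exists (P := fun y t => t = a ∧ ((Fin.snoc y t : Fin 2 → ℝ) ∘ ![1, 0]) ∈ _) ?_
    have h2 : IsSemialgebraic ℚ {w : Fin 2 → ℝ | w (Fin.last 1) = a ∧
        w ∈ (fun x : Fin 2 → ℝ => x ∘ ![1, 0]) ⁻¹'
          closure (graphOver {z : Fin 1 → ℝ | z 0 ∈ Ioo a b} (fun z : Fin 1 → ℝ => φ (z 0)))} :=
      sa_and (isSemialgebraic_setOf_apply_eq_of_isAlgebraic ha (Fin.last 1)) (hΓ.preimage_comp ![1, 0])
    convert h2 using 1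
    ext w
    simp only [mem_setOf_eq, Fin.snoc_init_self, mem_preimage]
  -- and it is the cluster set `{L}`
  have hsnoc : ∀ (y : Fin 1 → ℝ) (t : ℝ),
      ((Fin.snoc y t : Fin 2 → ℝ) ∘ ![1, 0]) = Fin.snoc (fun _ : Fin 1 => t) (y 0) := by
    intro y t; ext i; fin_cases i <;> simp [Fin.snoc]
  have hmem : ∀ y : Fin 1 → ℝ, (∃ t : ℝ, t = a ∧ ((Fin.snoc y t : Fin 2 → ℝ) ∘ ![1, 0]) ∈
      closure (graphOver {z : Fin 1 → ℝ | z 0 ∈ Ioo a b} (fun z : Fin 1 → ℝ => φ (z 0)))) ↔ y 0 = L := by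
    intro y
    constructor
    · rintro ⟨t, rfl, ht⟩
      rw [hsnoc, ← mem_clusterSet_iff_snoc_mem_closure, clusterSet_eq_singleton_of_tendsto hab hL] at ht
      exact ht
    · intro hy
      refine ⟨a, rfl, ?_⟩
      rw [hsnoc, ← mem_clusterSet_iff_snoc_mem_closure, clusterSet_eq_singleton_of_tendsto hab hL]
      exact hy
  have hfin : {y : Fin 1 → ℝ | ∃ t : ℝ, t = a ∧ ((Fin.snoc y t : Fin 2 → ℝ) ∘ ![1, 0]) ∈
      closure (graphOver {z : Fin 1 → ℝ | z 0 ∈ Ioo a b} (fun z : Fin 1 → ℝ => φ (z 0)))}.Finite := by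
    refine (finite_singleton (fun _ : Fin 1 => L)).subset fun y hy => ?_
    rw [mem_setOf_eq, hmem] at hy
    rw [mem_singleton_iff]
    funext i
    rw [Subsingleton.elim i 0, hy]
  exact isAlgebraic_of_mem_of_finite (x := fun _ : Fin 1 => L) hFsa hfin ((hmem _).2 rfl)

/-! ## Taylor coefficients of semialgebraic analytic germs -/

/-- `{z | z 0 ∈ (0, q)} ⊆ ℝ¹` is `ℚ`-semialgebraic for rational `q`. [folklore] -/
theorem isSemialgebraic_Ioo_zero_rat (q : ℚ) :
    IsSemialgebraic ℚ {z : Fin 1 → ℝ | z 0 ∈ Ioo (0 : ℝ) q} := by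
  refine sa_and (sa_pos 0) (sa_atom (MvPolynomial.X 0) (MvPolynomial.C q) fun z => ?_)
  simp

/-- The iterated derivatives of a function analytic on a neighbourhood of `[0, q)` with
`ℚ`-semialgebraic graph over `(0, q)`, `q ∈ ℚ`, have `ℚ`-semialgebraic graphs over `(0, q)`
(induction with `hasDerivAt_isSemialgebraic_holds`). [cite: BasuPollackRoy2006, Prop. 3.22] -/
theorem isSemialgebraicFunOn_iteratedDeriv {h : ℝ → ℝ} {q : ℚ} (hq : (0 : ℝ) < q)
    (han : ∀ s ∈ Ioo (0 : ℝ) q, AnalyticAt ℝ h s)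
    (hsa : IsSemialgebraicFunOn ℚ {z : Fin 1 → ℝ | z 0 ∈ Ioo (0 : ℝ) q} (fun z => h (z 0))) (n : ℕ) :
    IsSemialgebraicFunOn ℚ {z : Fin 1 → ℝ | z 0 ∈ Ioo (0 : ℝ) q} (fun z => iteratedDeriv n h (z 0)) := by
  induction n with
  | zero => simpa using hsa
  | succ n ih =>
    refine IsSemialgebraicFunOn.hasDerivAt_isSemialgebraic_holds 0 q (iteratedDeriv n h)
      (iteratedDeriv (n + 1) h) hq ih fun x hx => ?_
    rw [iteratedDeriv_succ]
    have hx' : AnalyticAt ℝ (iteratedDeriv n h) x := by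
      rw [iteratedDeriv_eq_iterate]; exact (han x hx).iterated_deriv n
    exact hx'.differentiableAt.hasDerivAt

/-- **Taylor coefficients of semialgebraic analytic germs are algebraic.** If `h` is real-analytic at
`0` and its graph over some `(0, δ)` is `ℚ`-semialgebraic, then every `h⁽ⁿ⁾(0)` is algebraic over `ℚ`
(the `n`-th derivative is `ℚ`-semialgebraic on a rational interval `(0, q)` and continuous at `0`;
`isAlgebraic_of_tendsto_nhdsGT`). [cite: BochnakCosteRoy1998, §2.9 and Prop. 2.2.2] -/
theorem isAlgebraic_iteratedDeriv {h : ℝ → ℝ} {δ : ℝ} (hδ : 0 < δ) (han : AnalyticAt ℝ h 0)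
    (hsa : IsSemialgebraicFunOn ℚ {z : Fin 1 → ℝ | z 0 ∈ Ioo (0 : ℝ) δ} (fun z => h (z 0))) (n : ℕ) :
    IsAlgebraic ℚ (iteratedDeriv n h 0) := by
  -- a rational radius inside the domain of analyticity and `(0, δ)`
  obtain ⟨ε, hε, hball⟩ := Metric.eventually_nhds_iff_ball.1 han.eventually_analyticAt
  obtain ⟨q, hq0, hqε⟩ := exists_rat_btwn (lt_min hε hδ)
  have hq0' : (0 : ℝ) < q := hq0
  have hqε' : (q : ℝ) < ε := lt_of_lt_of_le hqε (min_le_left _ _)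
  have hqδ : (q : ℝ) < δ := lt_of_lt_of_le hqε (min_le_right _ _)
  have hanq : ∀ s ∈ Ioo (0 : ℝ) q, AnalyticAt ℝ h s := fun s hs =>
    hball s (by rw [Metric.mem_ball, Real.dist_eq, sub_zero, abs_of_pos hs.1]; exact hs.2.trans hqε')
  have hsaq : IsSemialgebraicFunOn ℚ {z : Fin 1 → ℝ | z 0 ∈ Ioo (0 : ℝ) q} (fun z => h (z 0)) :=
    hsa.mono (fun z hz => ⟨hz.1, hz.2.trans hqδ⟩) (isSemialgebraic_Ioo_zero_rat q)
  have hsan := isSemialgebraicFunOn_iteratedDeriv hq0' hanq hsaq n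
  -- continuity of the `n`-th derivative at `0`
  have hcont : ContinuousAt (iteratedDeriv n h) 0 := by
    have : AnalyticAt ℝ (iteratedDeriv n h) 0 := by
      rw [iteratedDeriv_eq_iterate]; exact han.iterated_deriv n
    exact this.continuousAt
  have hlim : Tendsto (iteratedDeriv n h) (𝓝[>] (0 : ℝ)) (𝓝 (iteratedDeriv n h 0)) :=
    hcont.tendsto.mono_left nhdsWithin_le_nhds
  exact isAlgebraic_of_tendsto_nhdsGT hq0' isAlgebraic_zero hsan hlim

end PuiseuxGerm

/-- Registered anchor `helper_puiseuxGerm_limits` (item stmt-KontsevichZagierPeriods-11129): Taylor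
coefficients at `0` of a function analytic at `0` with `ℚ`-semialgebraic graph over `(0, δ)` are algebraic
(= `PuiseuxGerm.isAlgebraic_iteratedDeriv`). [cite: BochnakCosteRoy1998, §2.9 and Prop. 2.2.2] -/
theorem helper_puiseuxGerm_limits : ∀ {h : ℝ → ℝ} {δ : ℝ}, 0 < δ → AnalyticAt ℝ h 0 →
    IsSemialgebraicFunOn ℚ {z : Fin 1 → ℝ | z 0 ∈ Set.Ioo (0 : ℝ) δ} (fun z => h (z 0)) →
    ∀ n : ℕ, IsAlgebraic ℚ (iteratedDeriv n h 0) :=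
  fun hδ han hsa n => PuiseuxGerm.isAlgebraic_iteratedDeriv hδ han hsa n

end Summit.KontsevichZagierPeriods.SymplecticScissors.CurvePeriodsTransfer

end
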